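import Summits.MatrixMultiplication.OmegaCensus.ThreeSetLineModFourSliceTail
import Summits.MatrixMultiplication.OmegaCensus.ThreeSetLineModFourSliceSound
import HarnessLib

/-!
# The bit-sliced MOD-4 FILTER, IX: soundness of the tail-block checker; block split with a tail

ω-census `pub-omega`, family (b3), seat pub-omega-group gen 42.  Framing: lottery ticket; floor = certified bounds/negative
ranges.  VALUE: a kernel TOOL for the three-set cube cells `(4, d, e)@p²` (`ThreeSetZpCells4Core`); NOT progress on ω.
**`blockChkT_sound`** (via `LineMod.dead_of_survMask_testBit_of_digits`: the bumped sliced digits carry the residues of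
`pre ++ bumpHead c₀ l`) and **`forall_block_split_tail`**: a block `(compsLit (n+1) j).map (pre ++ ·)` is covered by its children
`c < c₀` and the tail block.
-/

namespace Summit.MatrixMultiplication.OmegaCensus

/-! # Soundness of the tail-block checker and the split with a tail -/

namespace LineMod

open Finset

/-- The constant digit carries `c` (below `L`). [folklore] -/
theorem val2_cst2 {k L : ℕ} (hk : k < L) (c : ℕ) : val2 k (cst2 (onesOf L) c) = (c : ZMod 4) := by
  rw [natCast_eq_bits, Nat.testBit_succ, Nat.testBit_zero, Nat.testBit_zero]
  have hone : (onesOf L).testBit k = true := by unfold onesOf; rw [Nat.testBit_two_pow_sub_one]; simp [hk]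
  unfold cst2 val2 bv
  by_cases h0 : c % 2 = 1 <;> by_cases h1 : c / 2 % 2 = 1 <;> simp [h0, h1, hone]

/-- Members of `compsLit n j` with `0 < n` are nonempty; `bumpHead` then adds `c₀` at position `0` only. [folklore] -/
theorem getD_bumpHead_append (pre : List ℕ) (c₀ : ℕ) {l : List ℕ} (hl : l ≠ []) (i : ℕ) :
    (pre ++ bumpHead c₀ l).getD i 0 = (pre ++ l).getD i 0 + if i = pre.length then c₀ else 0 := by
  obtain ⟨a, t, rfl⟩ := List.exists_cons_of_ne_nil hl
  rw [bumpHead]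
  by_cases hi : i < pre.length
  · rw [List.getD_append _ _ _ _ hi, List.getD_append _ _ _ _ hi, if_neg (by omega), add_zero]
  · push Not at hi
    rw [List.getD_append_right _ _ _ _ hi, List.getD_append_right _ _ _ _ hi]
    by_cases he : i = pre.length
    · rw [he, Nat.sub_self, List.getD_cons_zero, List.getD_cons_zero, if_pos rfl]
    · obtain ⟨m, hm⟩ : ∃ m, i - pre.length = m + 1 := ⟨i - pre.length - 1, by omega⟩
      rw [hm, List.getD_cons_succ, List.getD_cons_succ, if_neg he, add_zero]

section Sound

variable {p : ℕ} [NeZero p]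

/-- **Soundness of the tail-block checker.** [folklore] -/
theorem blockChkT_sound {K d e : ℕ} {W pre : List ℕ} {n j c₀ : ℕ} {sched : List Bool}
    (h : blockChkT p K d e W pre n j c₀ sched = true) :
    ∀ Fl ∈ (ZpZpDomino.compsLit n j).map (fun l => pre ++ bumpHead c₀ l), ∀ (G : ZMod p → ℕ) (s : ZMod p), (∀ u, G u ≤ e) →
      ¬ ∀ τ : ZMod p, (∑ u : ZMod p, lineMat3 (vecFn W) (vecFn Fl) τ u * G u) + (if s = τ then 1 else 0) = K := by
  intro Fl hFl G s _
  unfold blockChkT at h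
  dsimp only at h
  simp only [Bool.and_eq_true, decide_eq_true_eq, beq_iff_eq] at h
  obtain ⟨⟨⟨⟨⟨⟨⟨⟨_, hp3⟩, hWlen⟩, hlen⟩, hn⟩, hsum⟩, hc⟩, he⟩, hsm⟩ := h
  rw [List.mem_map] at hFl
  obtain ⟨l, hl, rfl⟩ := hFl
  obtain ⟨hllen, hlsum⟩ := length_sum_of_mem_compsLit n j l hl
  have hlne : l ≠ [] := by rintro rfl; simp at hllen; omega
  obtain ⟨_, hrep⟩ := blockPlanes_spec pre n j
  obtain ⟨k, hk, hbits⟩ := hrep l hl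
  have hFlen : (pre ++ bumpHead c₀ l).length = p := by
    obtain ⟨a, t, rfl⟩ := List.exists_cons_of_ne_nil hlne
    rw [bumpHead, List.length_append, List.length_cons, ← hlen, ← hllen, List.length_cons]
  have hFsum : (pre ++ bumpHead c₀ l).sum = d := by
    obtain ⟨a, t, rfl⟩ := List.exists_cons_of_ne_nil hlne
    rw [bumpHead, List.sum_append, List.sum_cons, ← hsum, ← hlsum, List.sum_cons]; ring
  refine dead_of_survMask_testBit_of_digits hp3 hWlen hFlen hFsum hc he hk (fun v => ?_) (by rw [hsm, Nat.zero_testBit]) G s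
  unfold toF vecFn bumpDigits
  rw [vget_range_map _ (ZMod.val_lt v), getD_bumpHead_append pre c₀ hlne, Nat.cast_add, natCast_eq_bits ((pre ++ l).getD v.val 0)]
  have hdig : val2 k (vget (sdigits p (blockPlanes pre n j).2) v.val) =
      (if ((pre ++ l).getD v.val 0).testBit 0 then 1 else 0) + 2 * (if ((pre ++ l).getD v.val 0).testBit 1 then 1 else 0) := by
    unfold sdigits
    rw [vget_range_map _ (ZMod.val_lt v)]
    unfold val2 bv
    rw [show ((blockPlanes pre n j).2.getD v.val []).getD 0 0 = pl (blockPlanes pre n j).2 v.val 0 from rfl,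
      show ((blockPlanes pre n j).2.getD v.val []).getD 1 0 = pl (blockPlanes pre n j).2 v.val 1 from rfl,
      hbits v.val 0 (by norm_num), hbits v.val 1 (by norm_num)]
  by_cases hv : v.val = pre.length
  · rw [if_pos hv, if_pos hv, val2_add2, hdig, val2_cst2 hk]
  · rw [if_neg hv, if_neg hv, hdig, Nat.cast_zero, add_zero]

end Sound

/-- **Block split with a tail.**  A block `(compsLit (n+1) j).map (pre ++ ·)` is covered by its children `c < c₀` and the tail
block of the data with first free entry `≥ c₀`. [folklore] -/
theorem forall_block_split_tail {P : List ℕ → Prop} (pre : List ℕ) (n j c₀ : ℕ)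
    (h : ∀ c, c < c₀ → ∀ Fl ∈ (ZpZpDomino.compsLit n (j - c)).map ((pre ++ [c]) ++ ·), P Fl)
    (ht : ∀ Fl ∈ (ZpZpDomino.compsLit (n + 1) (j - c₀)).map (fun l => pre ++ bumpHead c₀ l), P Fl) :
    ∀ Fl ∈ (ZpZpDomino.compsLit (n + 1) j).map (pre ++ ·), P Fl := by
  intro Fl hFl
  rw [List.mem_map] at hFl
  obtain ⟨l, hl, rfl⟩ := hFl
  have hl' := hl
  rw [ZpZpDomino.compsLit, List.mem_flatMap] at hl'
  obtain ⟨c, hc, hl'⟩ := hl'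
  rw [List.mem_map] at hl'
  obtain ⟨l', hl'', rfl⟩ := hl'
  rw [List.mem_range] at hc
  by_cases hcc : c < c₀
  · exact h c hcc _ (List.mem_map.2 ⟨l', hl'', by rw [List.append_assoc]; rfl⟩)
  · push Not at hcc
    obtain ⟨h1, h2⟩ := length_sum_of_mem_compsLit n (j - c) l' hl''
    have hmem : (c - c₀) :: l' ∈ ZpZpDomino.compsLit (n + 1) (j - c₀) :=
      ZpZpDomino.mem_compsLit _ _ _ (by rw [List.length_cons, h1]) (by rw [List.sum_cons, h2]; omega)
    refine ht _ (List.mem_map.2 ⟨(c - c₀) :: l', hmem, ?_⟩)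
    show pre ++ ((c - c₀ + c₀) :: l') = pre ++ (c :: l')
    rw [Nat.sub_add_cancel hcc]

end LineMod

end Summit.MatrixMultiplication.OmegaCensus
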